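import Literature.NumberTheory.EllipticCurves.TowerSaturatedCartesianProofs
import Literature.NumberTheory.EllipticCurves.ZpExtensionEisensteinSelmerTowerCompatProofs
import Mathlib.RingTheory.Ideal.Span
import HarnessLib

/-!
# Saturated level conditions are cartesian along `π`-power morphisms (the `R`-linear / π-adic form of the
# abstract core of Howard's H.3), propagation down a tower, and transport along morphisms of towers

`Proofs` file (theorems only; no definition, no named fact, no `sorry`), in the currency of the tree's abstract towers
`Literature.NumberTheory.EllipticCurves.Tower.*` (`compatibleFamilies`, `saturatedFamilies`, `levelCondition`, `redIter`,
`map_levelCondition_succ_eq`; files `ZpExtensionEisensteinSelmerStructure.lean`, `TowerSaturatedCartesianProofs.lean`,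
`ZpExtensionEisensteinSelmerTowerCompatProofs.lean`).

Howard 2004, Hypothesis H.3 (arXiv:1202.6340, p. 7 L65–67): «for every `v ∈ Σ(F)` the local condition `F` at `v` is
cartesian on the category `Quot(T)`», where the objects of `Quot(T)` are the quotients `T/IT` by the ideals `I` of the
coefficient ring `R` and the morphisms are induced by scalars `r` with `rI ⊂ J` (Def. 1.1.3, p. 5 L93–99).  For the
specialised structure `F_𝔮` of Def. 3.1.2 the level ring at level `k` is `A_{m,k} = S_𝔮/π^{mk}` (`S_𝔮 = Λ/(T^m + p)` a
DVR with uniformiser `π`, `π^m = -p`), whose ideals are ALL the powers `(π^i)`, `0 ≤ i ≤ mk`, and whose injective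
`Quot`-morphisms out of a non-zero object are the unit multiples of `×π^{j-i} : T/π^i T → T/π^j T` (file
`Howard2004/QuotCartesianReductionProofs`).  The tree's abstract core `Tower.comap_levelCondition_eq_of_liftable`
(x10b-p2, `TowerSaturatedCartesianProofs`) treats the morphisms `×p^d` between the `p`-adic levels; the present file is
its `R`-LINEAR form, for a tower of `R`-modules with `R`-linear reductions and `R`-stable cores (Howard Def. 1.1.1: «a
local condition … is an `R`-submodule»; in the tree `cond_smul` / `isScalarStable_eisensteinSelmerStructure`), along a
level map `mul` with `mul ∘ red^{(d)} = π^d` for an element `π ∈ R` dividing `p` — which is what the π-adic refinement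
`… → T/π^{i+1} → T/π^i → …` of the Eisenstein tower needs (D1 memo `HOME/p1/H3-CARTESIAN-PLAN`, remark (2)).
Saturation stays by `p`-powers, exactly as in `Tower.saturatedFamilies`; for `π ∣ p` and `R`-stable cores it is the same
as `π`-saturation, which is how the last step of the proof goes through.

Contents (all `[folklore]`-level algebra on top of Howard's definitions):
* §1 `R`-linearity bookkeeping: `smul_mem_compatibleFamilies`, `smul_mem_saturatedFamilies`, `smul_mem_levelCondition`
  (the level conditions are `R`-stable), `redIter_smul`.
* §2 propagation DOWN the tower: `map_redIter_levelCondition` — the level-`i` condition is the image of the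
  level-`(i+d)` condition under `red^{(d)}` (iterating the tree's `map_levelCondition_succ_eq`; Howard Def. 1.1.3: the
  condition on `T/π^iT` propagated from `T` is the one propagated from `T/π^{i+d}T`; used to identify the propagated
  conditions on the objects of `Quot(T_k)`), `redIter_mem_levelCondition`.
* §3 **`comap_levelCondition_eq_of_liftable_smul`**: along `mul : H_i → H_{i+d}` with (M_π) `mul (red^{(d)} y) = π^d • y`,
  on a tower with (T_π) `π^i • H_i = 0`, (L) liftability, (E_π) `x_{i+d} = 0 ⇒ x = π^{i+d} • h` (h compatible), and
  `p ∈ (π)`: `mul⁻¹(L_{i+d}) = L_i`.  Also the easy inclusion `levelCondition_le_comap_smul` from (M_π) alone.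
  (`π := p` recovers x10b-p2's statement.)
* §4 transport along a morphism of towers with cores `e_j : H_j → H'_j` (`e ∘ red = red' ∘ e`, `e_j(C_j) ⊆ C'_j`):
  `map_levelCondition_le`, and `map_levelCondition_eq` when the `e_j` are bijective with `e_j(C_j) = C'_j` — used to move
  between two presentations of the same tower (e.g. `T_𝔮/p^k` as a level of the `p`-adic tower and as the level `mk` of its
  π-adic refinement).

Cell `pub/bsd-print-x9`, shared μ-item of rows 9/10 (D1 road, Howard's `SatisfiesH.h3`); seat `bsd-line-x10b-p1-w6`.
No statement about elliptic curves or Selmer groups is made here; BSD is not proved by any of this.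

References: B. Howard, Compositio Math. 140 (2004), Def. 1.1.1–1.1.3, H.3, Def. 3.1.2 (arXiv:1202.6340 p. 5 L20–44 and
L88–99, p. 7 L65–67, p. 15–16); B. Mazur, K. Rubin, *Kolyvagin systems* (2004), Lemma 3.7.1; J.-P. Serre, *Galois
Cohomology* (1997), I §2.2.
-/

noncomputable section

universe u v

namespace Literature.NumberTheory.EllipticCurves

namespace Tower

/-! ## §1 `R`-linear towers: the scalar action on compatible / saturated families and level conditions -/

section Smul

variable {R : Type v} [CommRing R] {H : ℕ → Type u} [∀ j, AddCommGroup (H j)] [∀ j, Module R (H j)]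
  (red : ∀ j, H (j + 1) →+ H j)

/-- For `R`-linear reductions, a scalar multiple of a compatible family is compatible.
[cite: SerreGaloisCohomology1997, Ch. I §2.2 (functoriality of the inverse limit)] -/
theorem smul_mem_compatibleFamilies (hred : ∀ (j : ℕ) (r : R) (x : H (j + 1)), red j (r • x) = r • red j x)
    {x : Π j, H j} (hx : x ∈ compatibleFamilies red) (r : R) : r • x ∈ compatibleFamilies red := by
  rw [mem_compatibleFamilies_iff] at hx ⊢
  intro j
  rw [Pi.smul_apply, Pi.smul_apply, hred, hx j]

/-- For `R`-linear reductions and `R`-stable cores, a scalar multiple of a saturated family is saturated (same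
exponent): `p^a • (r • x_j) = r • (p^a • x_j) ∈ C_j`. [cite: Howard2004HeegnerKolyvagin, Def. 1.1.1 (arXiv Def. 2.1.1, p. 5 L20–21: local conditions are R-submodules) and Def. 3.1.2] -/
theorem smul_mem_saturatedFamilies (hred : ∀ (j : ℕ) (r : R) (x : H (j + 1)), red j (r • x) = r • red j x)
    (p : ℕ) (C : ∀ j, AddSubgroup (H j)) (hC : ∀ (j : ℕ) (r : R) (y : H j), y ∈ C j → r • y ∈ C j)
    {x : Π j, H j} (hx : x ∈ saturatedFamilies red p C) (r : R) : r • x ∈ saturatedFamilies red p C := by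
  obtain ⟨hxc, a, ha⟩ := hx
  refine ⟨smul_mem_compatibleFamilies red hred hxc r, a, fun j => ?_⟩
  rw [Pi.smul_apply, smul_comm]
  exact hC j r _ (ha j)

/-- **The level conditions of an `R`-linear tower with `R`-stable cores are `R`-stable** (Howard: local conditions
are `R`-submodules; tree: `cond_smul`). [cite: Howard2004HeegnerKolyvagin, Def. 1.1.1 (arXiv p. 5 L20–21) and Def. 3.1.2] -/
theorem smul_mem_levelCondition (hred : ∀ (j : ℕ) (r : R) (x : H (j + 1)), red j (r • x) = r • red j x)
    (p : ℕ) (C : ∀ j, AddSubgroup (H j)) (hC : ∀ (j : ℕ) (r : R) (y : H j), y ∈ C j → r • y ∈ C j)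
    (k : ℕ) {y : H k} (hy : y ∈ levelCondition red p C k) (r : R) : r • y ∈ levelCondition red p C k := by
  obtain ⟨x, hx, rfl⟩ := (mem_levelCondition_iff red p C k y).mp hy
  exact (mem_levelCondition_iff red p C k _).mpr
    ⟨r • x, smul_mem_saturatedFamilies red hred p C hC hx r, rfl⟩

/-- The iterated reduction is `R`-linear when the reductions are. [cite: SerreGaloisCohomology1997, Ch. I §2.2] -/
theorem redIter_smul (hred : ∀ (j : ℕ) (r : R) (x : H (j + 1)), red j (r • x) = r • red j x)
    (i d : ℕ) (r : R) (y : H (i + d)) : redIter red i d (r • y) = r • redIter red i d y := by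
  induction d with
  | zero => rfl
  | succ d ih => rw [redIter_succ, redIter_succ, hred, ih]

end Smul

/-! ## §2 Propagation down the tower: `L_i = red^{(d)}(L_{i+d})` -/

section Down

variable {H : ℕ → Type u} [∀ j, AddCommGroup (H j)] (red : ∀ j, H (j + 1) →+ H j)

/-- **The level-`i` condition is the image of the level-`(i+d)` condition under `red^{(d)}`** (propagation is
functorial over `Quot(T)`). [cite: Howard2004HeegnerKolyvagin, Def. 1.1.3 (arXiv Def. 2.1.3, p. 5 L93–99)] -/
theorem map_redIter_levelCondition (p : ℕ) (C : ∀ j, AddSubgroup (H j)) (i d : ℕ) :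
    (levelCondition red p C (i + d)).map (redIter red i d) = levelCondition red p C i := by
  induction d with
  | zero =>
    ext y
    simp only [AddSubgroup.mem_map, redIter_zero, exists_eq_right]
    rfl
  | succ d ih =>
    have h : redIter red i (d + 1) = (redIter red i d).comp (red (i + d)) := rfl
    have h2 : (levelCondition red p C (i + (d + 1))).map (red (i + d)) = levelCondition red p C (i + d) :=
      map_levelCondition_succ_eq red p C (i + d)
    rw [h, ← AddSubgroup.map_map, h2, ih]

/-- On compatible families `red^{(d)}` of the `(i+d)`-component is the `i`-component, so a class of the level-`(i+d)`
condition reduces INTO the level-`i` condition. [cite: Howard2004HeegnerKolyvagin, Def. 1.1.3 (arXiv p. 5 L93–99)] -/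
theorem redIter_mem_levelCondition (p : ℕ) (C : ∀ j, AddSubgroup (H j)) (i d : ℕ) {y : H (i + d)}
    (hy : y ∈ levelCondition red p C (i + d)) : redIter red i d y ∈ levelCondition red p C i := by
  rw [← map_redIter_levelCondition red p C i d]
  exact AddSubgroup.mem_map_of_mem _ hy

end Down

/-! ## §3 The cartesian property along `π`-power morphisms -/

section Cartesian

variable {R : Type v} [CommRing R] {H : ℕ → Type u} [∀ j, AddCommGroup (H j)] [∀ j, Module R (H j)]
  (red : ∀ j, H (j + 1) →+ H j)

/-- **The easy inclusion, `R`-linear form**: along a level map `mul : H_i → H_{i+d}` with (M_π) `mul ∘ red^{(d)} = π^d •`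
(the `Quot`-morphism `×π^d : T/π^iT → T/π^{i+d}T` on cohomology), the level-`i` condition maps into the
level-`(i+d)` condition: `mul (x_i) = π^d • x_{i+d}` and `π^d • x` is saturated with `x`.
[cite: Howard2004HeegnerKolyvagin, Def. 1.1.2–1.1.3 and H.3 (arXiv p. 5 L88–99, p. 7 L65–67)] -/
theorem levelCondition_le_comap_smul (hred : ∀ (j : ℕ) (r : R) (x : H (j + 1)), red j (r • x) = r • red j x)
    (p : ℕ) (C : ∀ j, AddSubgroup (H j)) (hC : ∀ (j : ℕ) (r : R) (y : H j), y ∈ C j → r • y ∈ C j)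
    (i d : ℕ) (mul : H i →+ H (i + d)) (π : R) (hM : ∀ y : H (i + d), mul (redIter red i d y) = π ^ d • y) :
    levelCondition red p C i ≤ (levelCondition red p C (i + d)).comap mul := by
  intro y hy
  rw [AddSubgroup.mem_comap, mem_levelCondition_iff]
  obtain ⟨x, hx, rfl⟩ := (mem_levelCondition_iff red p C i y).mp hy
  refine ⟨π ^ d • x, smul_mem_saturatedFamilies red hred p C hC hx _, ?_⟩
  rw [Pi.smul_apply, ← hM,
    redIter_apply_of_mem_compatibleFamilies red (saturatedFamilies_le_compatibleFamilies red p C hx) i d]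

/-- **Saturated level conditions are CARTESIAN along the `π`-power morphisms** (`R`-linear form of the abstract core
of Howard's H.3; x10b-p2's `comap_levelCondition_eq_of_liftable` is the case `π = p`).  Tower of `R`-modules with
`R`-linear reductions and `R`-stable cores; `mul : H_i → H_{i+d}` with (M_π) `mul ∘ red^{(d)} = π^d •`; (T_π)
`π^i • H_i = 0`; (L) liftability of the classes whose image under `mul` lifts; (E_π) a compatible family vanishing at
level `i + d` is `π^{i+d} • h` for a compatible `h`; and `p ∈ (π)`.  Then `mul⁻¹(L_{i+d}) = L_i`.  Proof of `⊆`
(D1's memo verbatim, with `π` for `p`): `mul y = x_{i+d}` (`x` saturated); lift `y = z_i` (L); `(π^d • z - x)_{i+d} = 0`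
by (M_π), so `π^d • z - x = π^{i+d} • h` (E_π); `z' := z - π^i • h` has `z'_i = y` (T_π) and `π^d • z' = x`; from
`p = c π`, `p^{a+d} • z'_j = c^d • (p^a • x_j) ∈ C_j`, so `z'` is saturated and `y ∈ L_i`.
[cite: Howard2004HeegnerKolyvagin, H.3 and Def. 3.1.2 / Prop. 2.1.3 proof (arXiv p. 7 L65–67, p. 15 L99–108, p. 16 L1–3)]
[cite: MazurRubinMemoirs2004, Lemma 3.7.1] -/
theorem comap_levelCondition_eq_of_liftable_smul
    (hred : ∀ (j : ℕ) (r : R) (x : H (j + 1)), red j (r • x) = r • red j x)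
    (p : ℕ) (C : ∀ j, AddSubgroup (H j)) (hC : ∀ (j : ℕ) (r : R) (y : H j), y ∈ C j → r • y ∈ C j)
    (i d : ℕ) (mul : H i →+ H (i + d)) (π : R) (hp : ((p : ℕ) : R) ∈ Ideal.span {π})
    (hM : ∀ y : H (i + d), mul (redIter red i d y) = π ^ d • y)
    (hT : ∀ y : H i, π ^ i • y = 0)
    (hL : ∀ y : H i, (∃ x ∈ compatibleFamilies red, mul y = x (i + d)) →
      ∃ z ∈ compatibleFamilies red, z i = y)
    (hE : ∀ x ∈ compatibleFamilies red, x (i + d) = 0 →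
      ∃ h ∈ compatibleFamilies red, x = π ^ (i + d) • h) :
    (levelCondition red p C (i + d)).comap mul = levelCondition red p C i := by
  refine le_antisymm ?_ (levelCondition_le_comap_smul red hred p C hC i d mul π hM)
  intro y hy
  rw [AddSubgroup.mem_comap, mem_levelCondition_iff] at hy
  obtain ⟨x, hx, hxy⟩ := hy
  have hxc : x ∈ compatibleFamilies red := saturatedFamilies_le_compatibleFamilies red p C hx
  -- (L): lift `y` to a compatible family `z`
  obtain ⟨z, hz, rfl⟩ := hL y ⟨x, hxc, hxy.symm⟩
  -- (M_π): `mul (z i) = π^d • z (i+d)`, so `π^d • z - x` vanishes at level `i + d`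
  have hmul : mul (z i) = π ^ d • z (i + d) := by
    rw [← redIter_apply_of_mem_compatibleFamilies red hz i d, hM]
  have hvan : (π ^ d • z - x) (i + d) = 0 := by
    rw [Pi.sub_apply, Pi.smul_apply, ← hmul, hxy, sub_self]
  -- (E_π): `π^d • z - x = π^(i+d) • h`
  obtain ⟨h, hh, hzx⟩ :=
    hE (π ^ d • z - x) (sub_mem (smul_mem_compatibleFamilies red hred hz _) hxc) hvan
  -- `p = c * π`
  obtain ⟨c, hc⟩ := Ideal.mem_span_singleton'.mp hp
  -- `z' := z - π^i • h` is saturated, with `z'_i = z_i`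
  obtain ⟨a, ha⟩ := ((mem_saturatedFamilies_iff red p C x).mp hx).2
  have hz'x : π ^ d • (z - π ^ i • h) = x := by
    rw [smul_sub, ← mul_smul, ← pow_add, add_comm d i, ← hzx, sub_sub_cancel]
  have hz' : z - π ^ i • h ∈ saturatedFamilies red p C := by
    refine (mem_saturatedFamilies_iff red p C _).mpr ⟨?_, a + d, fun j => ?_⟩
    · exact (mem_compatibleFamilies_iff red _).mp
        (sub_mem hz (smul_mem_compatibleFamilies red hred hh _))
    · -- `p^(a+d) • z'_j = c^d • (p^a • x_j) ∈ C_j`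
      have hpd : ((p ^ d : ℕ) : R) = c ^ d * π ^ d := by
        rw [Nat.cast_pow, ← hc, mul_pow]
      have hj : (p ^ d) • (z - π ^ i • h) j = c ^ d • x j := by
        rw [← Nat.cast_smul_eq_nsmul R, hpd, mul_smul, ← Pi.smul_apply (π ^ d), hz'x]
      rw [pow_add, mul_smul, hj, smul_comm]
      exact hC j _ _ (ha j)
  have hzi : (z - π ^ i • h) i = z i := by
    rw [Pi.sub_apply, Pi.smul_apply, hT, sub_zero]
  rw [← hzi]
  exact apply_mem_levelCondition red p C hz' i

end Cartesian

/-! ## §4 Transport along a morphism of towers with cores -/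

section Transport

variable {H : ℕ → Type u} [∀ j, AddCommGroup (H j)] (red : ∀ j, H (j + 1) →+ H j)
  {H' : ℕ → Type v} [∀ j, AddCommGroup (H' j)] (red' : ∀ j, H' (j + 1) →+ H' j)
  (e : ∀ j, H j →+ H' j)

/-- A morphism of towers maps compatible families to compatible families. [cite: SerreGaloisCohomology1997, Ch. I §2.2 (functoriality of the inverse limit)] -/
theorem comp_mem_compatibleFamilies (he : ∀ (j : ℕ) (x : H (j + 1)), e j (red j x) = red' j (e (j + 1) x))
    {x : Π j, H j} (hx : x ∈ compatibleFamilies red) : (fun j => e j (x j)) ∈ compatibleFamilies red' := by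
  rw [mem_compatibleFamilies_iff] at hx ⊢
  intro j
  rw [← he, hx j]

/-- A morphism of towers carrying cores into cores maps saturated families to saturated families (same exponent).
[cite: Howard2004HeegnerKolyvagin, Def. 1.1.1 (arXiv p. 5 L36–44: propagation along a morphism)] -/
theorem comp_mem_saturatedFamilies (he : ∀ (j : ℕ) (x : H (j + 1)), e j (red j x) = red' j (e (j + 1) x))
    (p : ℕ) (C : ∀ j, AddSubgroup (H j)) (C' : ∀ j, AddSubgroup (H' j)) (hCC' : ∀ j, (C j).map (e j) ≤ C' j)
    {x : Π j, H j} (hx : x ∈ saturatedFamilies red p C) :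
    (fun j => e j (x j)) ∈ saturatedFamilies red' p C' := by
  obtain ⟨hxc, a, ha⟩ := hx
  refine ⟨comp_mem_compatibleFamilies red red' e he hxc, a, fun j => ?_⟩
  rw [← map_nsmul]
  exact hCC' j (AddSubgroup.mem_map_of_mem _ (ha j))

/-- **A morphism of towers carrying cores into cores maps level conditions into level conditions.**
[cite: Howard2004HeegnerKolyvagin, Def. 1.1.1–1.1.3 (arXiv p. 5 L36–44, L93–99)] -/
theorem map_levelCondition_le (he : ∀ (j : ℕ) (x : H (j + 1)), e j (red j x) = red' j (e (j + 1) x))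
    (p : ℕ) (C : ∀ j, AddSubgroup (H j)) (C' : ∀ j, AddSubgroup (H' j)) (hCC' : ∀ j, (C j).map (e j) ≤ C' j)
    (k : ℕ) : (levelCondition red p C k).map (e k) ≤ levelCondition red' p C' k := by
  rintro _ ⟨y, hy, rfl⟩
  obtain ⟨x, hx, rfl⟩ := (mem_levelCondition_iff red p C k y).mp hy
  exact (mem_levelCondition_iff red' p C' k _).mpr
    ⟨fun j => e j (x j), comp_mem_saturatedFamilies red red' e he p C C' hCC' hx, rfl⟩

/-- **An ISOMORPHISM of towers identifying the cores identifies the level conditions** (used to pass between two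
presentations of the same tower, e.g. the `p`-adic levels `T_𝔮/p^k` and the levels `mk` of the π-adic refinement).
[cite: Howard2004HeegnerKolyvagin, Def. 1.1.3 (arXiv p. 5 L93–99: the objects T/IT up to their canonical isomorphism)] -/
theorem map_levelCondition_eq (he : ∀ (j : ℕ) (x : H (j + 1)), e j (red j x) = red' j (e (j + 1) x))
    (hbij : ∀ j, Function.Bijective (e j))
    (p : ℕ) (C : ∀ j, AddSubgroup (H j)) (C' : ∀ j, AddSubgroup (H' j)) (hCC' : ∀ j, (C j).map (e j) = C' j)
    (k : ℕ) : (levelCondition red p C k).map (e k) = levelCondition red' p C' k := by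
  refine le_antisymm (map_levelCondition_le red red' e he p C C' (fun j => (hCC' j).le) k) ?_
  intro y' hy'
  obtain ⟨x', hx', rfl⟩ := (mem_levelCondition_iff red' p C' k y').mp hy'
  -- pull the saturated family `x'` back along the bijections
  choose g hg using fun j => (hbij j).2
  have hinj : ∀ j, Function.Injective (e j) := fun j => (hbij j).1
  set x : Π j, H j := fun j => g j (x' j) with hxdef
  have hex : ∀ j, e j (x j) = x' j := fun j => hg j (x' j)
  have hxc : x ∈ compatibleFamilies red := by
    rw [mem_compatibleFamilies_iff]
    intro j
    apply hinj j
    rw [he, hex, hex]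
    exact (mem_compatibleFamilies_iff red' x').mp (saturatedFamilies_le_compatibleFamilies red' p C' hx') j
  obtain ⟨a, ha⟩ := ((mem_saturatedFamilies_iff red' p C' x').mp hx').2
  have hxs : x ∈ saturatedFamilies red p C := by
    refine ⟨hxc, a, fun j => ?_⟩
    have h1 : e j (p ^ a • x j) ∈ C' j := by rw [map_nsmul, hex]; exact ha j
    rw [← hCC' j] at h1
    obtain ⟨w, hw, hwe⟩ := h1
    rwa [← hinj j hwe]
  exact ⟨x k, apply_mem_levelCondition red p C hxs k, hex k⟩

end Transport

end Tower

end Literature.NumberTheory.EllipticCurves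

end
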